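import Literature.GroupTheory.SpecificGroups.PGL2BorelCharP
import Mathlib.FieldTheory.Finite.Basic
import HarnessLib

/-!
# Finite subgroups of `PGL₂(k)` in characteristic `p`, III: counting `p`-elements (Faber's
Lemma 6.3)

Topic `GroupTheory/SpecificGroups`; theorems plus small definitions (`shiftInfty`, the
polynomials `cosetQuad`, `cosetLin`), no named facts.  Third part of Dickson's classification of
the finite `p`-irregular subgroups of `PGL₂(k)` following X. Faber, *Finite `p`-irregular
subgroups of `PGL₂(k)*`, arXiv:1112.1999 = La Matematica 2 (2023) [Faber2011], §6 up to and
including Lemma 6.3 and the opening of §6.1 (the equality case), after L. E. Dickson, *Linear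
groups* (1901), Ch. XII [Dickson1901]; parts I–II are `PGL2SylowCharP`, `PGL2BorelCharP`.  Use:
the input "classification of finite subgroups of `PGL₂(𝔽̄_q)`" of Newton–Thorne, *Symmetric
power functoriality, II*, Publ. IHES 134 (2021), proof of Prop. 3.7 [NewtonThorneIHES2021b].

## Setting and contents (all proved)

`k` algebraically closed of characteristic `p`, `H ≤ PGL₂(k)` finite, `P ≠ 1` a Sylow
`p`-subgroup of order `q` fixing `∞` (so `P` = the translations `τ_β`, `β ∈ Γ(H)`, and
`N_H(P) = Stab_H(∞)` of order `q d`, `d = |Λ(H)|`, parts I–II), `ε_2 = 1`, `ε_p = 2` for odd `p`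
(written `if p = 2 then 1 else 2`).

* `shiftInfty` (`[g] ↦ g₀₁/g₁₁`, the translation part: `h = τ_{shiftInfty h} δ_{derivInfty h}`
  for `h` fixing `∞`, `eq_transl_shiftInfty_mul_homoth`).
* `cosetQuad g a = (g₁₀ X + (g₀₀ a + g₁₁))² - 4 a det g`, `cosetLin g a = g₁₀ X + (g₀₀ a + g₁₁)`
  and `mk_mul_transl_mul_homoth_pow_char_eq_one_iff`: **`[g] τ_μ δ_a` is a `p`-element iff
  `cosetQuad g a (μ) = 0`** (Faber's (6.0.3) `(α λ + γ μ + δ)² = 4 λ det s`, via the trace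
  criterion of part II); `card_le_eps_of_forall_pow_char_eq_one` (at most `ε_p` such `μ`).
* `card_fibre_le`: for `s` not fixing `∞` and a multiplier `l`, at most `ε_p` elements
  `n ∈ Stab_H(∞)` with `n'(∞) = l` make `s n` a `p`-element;
  `card_stabilizer_mul_pow_char_eq_one_le`: at most `ε_p d` per coset `s Stab_H(∞)`.
* `sylow_inf_eq_bot_of_ne` (Sylow `p`-subgroups are TI), `card_sylow_eq_index`
  (`n_p = [H : Stab_H(∞)]`), `card_sylow_sub_one_mul_le_card` (**at least `(n_p - 1)(q - 1)`
  `p`-elements off `Stab_H(∞)`**, Faber (6.0.1)), `card_le_sum_section`,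
  `card_le_index_sub_one_mul` (**at most `(n_p - 1) ε_p d`**).
* `card_sylow_sub_one_le`: **Faber's Lemma 6.3, `q - 1 ≤ ε_p d`** (for `P` not normal).
* `eps_le_card_fibre_of_eq`: **the equality case** `q - 1 = ε_p d` forces, for every `s ∈ H` not
  fixing `∞` and every multiplier `l`, at least (hence exactly) `ε_p` elements `n` with
  `n'(∞) = l`, `(s n)^p = 1` (Faber §6.1, first paragraph).
* Consequences (Faber, end of proof of Lemma 6.3): `pow_eq_pow_of_pow_sub_one_le`,
  `card_stabField_eq` (**`|𝔽_Γ| = |Γ| = q`, i.e. `ℓ = m`**), `exists_mem_stabField_mul_eq`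
  (`Γ = 𝔽_Γ β₀`), `coe_Gamma_eq_stabField` (**normalised: `Γ(H) = 𝔽_q` a subfield of `k`** when
  `1 ∈ Γ`), `card_Lambda_dvd` (`d ∣ q - 1`, `Λ ↪ 𝔽_qˣ`), `card_Lambda_eq_or` (**`d = q - 1`, or
  `p` odd and `2d = q - 1`** — Faber's "`Λ = 𝔽_qˣ` or `(𝔽_qˣ)²`" at the level of orders).

## What is NOT here

§6.1 (`Λ = (𝔽_qˣ)²` ⇒ `H = PSL₂(𝔽_q)`; `q = 2` dihedral) and §6.2 (`Λ = 𝔽_qˣ` ⇒ `H = PGL₂(𝔽_q)` or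
`𝔄₅`), and the assembled classification: parts IV–V.

## References

* [Faber2011] X. Faber, *Finite p-irregular subgroups of PGL₂(k)*, arXiv:1112.1999 (2011); La
  Matematica 2 (2023) 479–522 — §6, (6.0.1)–(6.0.4), Lemma 6.3, Lemma 6.4, §6.1 first
  paragraph (read 2026-08-15, `lit read arxiv:1112.1999`, chunks p0016–p0017).
* [Dickson1901] L. E. Dickson, *Linear groups with an exposition of the Galois field theory*,
  Teubner (1901), Ch. XII §§249–254.
* [NewtonThorneIHES2021b] J. Newton, J. A. Thorne, *Symmetric power functoriality for
  holomorphic modular forms, II*, Publ. Math. IHÉS 134 (2021), proof of Prop. 3.7.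
-/

open scoped MatrixGroups OnePoint Pointwise
open Matrix MulAction

namespace Literature.GroupTheory.SpecificGroups.PGL2

open Literature.NumberTheory.GaloisRepresentations

variable {k : Type*} [Field k]

local notation "M₂" => Matrix (Fin 2) (Fin 2) k


section Shift

/-- The ratio `g₀₁ / g₁₁` — for `g` upper triangular, the translation part `β` of
`[g] = τ_β δ_a`; it only depends on the class of `g`. [folklore] -/
def shiftInfty (h : PGL(Fin 2, k)) : k :=
  Quotient.liftOn' h (fun g : GL (Fin 2) k => g 0 1 / g 1 1) (by
    intro a b hab
    rw [QuotientGroup.leftRel_apply, Matrix.GeneralLinearGroup.center_eq_range_scalar] at hab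
    obtain ⟨u, hu⟩ := hab
    have hb : b = a * Matrix.GeneralLinearGroup.scalar (Fin 2) u := by
      rw [hu, mul_inv_cancel_left]
    have hval : ((b : GL (Fin 2) k) : M₂) = (u : k) • (a : M₂) := by
      rw [hb, GL2.coe_mul_scalar]
    change (a : M₂) 0 1 / (a : M₂) 1 1 = (b : M₂) 0 1 / (b : M₂) 1 1
    rw [hval, Matrix.smul_apply, Matrix.smul_apply, smul_eq_mul, smul_eq_mul,
      mul_div_mul_left _ _ u.ne_zero])

/-- `shiftInfty [g] = g₀₁ / g₁₁`. [folklore] -/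
theorem shiftInfty_mk (g : GL (Fin 2) k) :
    shiftInfty (Matrix.ProjGenLinGroup.mk g) = g 0 1 / g 1 1 := rfl

/-- `shiftInfty (τ_β δ_a) = β`. [folklore] -/
@[simp] theorem shiftInfty_transl_mul_homoth (β : k) (a : kˣ) :
    shiftInfty (transl β * homoth a) = β := by
  rw [homoth_apply, transl_apply, ← map_mul, shiftInfty_mk]
  simp [Matrix.GeneralLinearGroup.upperRightHom_apply]

variable [DecidableEq k]

/-- **Coordinates on the stabiliser of `∞`**: an element fixing `∞` is `τ_β δ_a` with
`β = shiftInfty h` and `a = derivInfty h`. [cite: Faber2011, §4.4] -/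
theorem eq_transl_shiftInfty_mul_homoth {h : PGL(Fin 2, k)} (hh : h • (∞ : OnePoint k) = ∞) :
    h = transl (shiftInfty h) * homoth (Units.mk0 (derivInfty h) (derivInfty_ne_zero hh)) := by
  obtain ⟨β, a, ha, rfl⟩ := exists_eq_transl_mul_homoth hh
  rw [shiftInfty_transl_mul_homoth]
  congr 1
  congr 1
  exact Units.ext (by rw [Units.val_mk0, ← ha])

/-- Two elements fixing `∞` with the same derivative and the same shift are equal. [folklore] -/
theorem eq_of_derivInfty_eq_of_shiftInfty_eq {h h' : PGL(Fin 2, k)} (hh : h • (∞ : OnePoint k) = ∞)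
    (hh' : h' • (∞ : OnePoint k) = ∞) (hd : derivInfty h = derivInfty h')
    (hs : shiftInfty h = shiftInfty h') : h = h' := by
  rw [eq_transl_shiftInfty_mul_homoth hh, eq_transl_shiftInfty_mul_homoth hh', hs]
  congr 2
  exact Units.ext (by rw [Units.val_mk0, Units.val_mk0, hd])

end Shift

/-! ### The trace condition along a coset of the stabiliser of `∞` -/

section CosetCount

/-- The lift `g (1 μ; 0 1) (a 0; 0 1) = (g₀₀ a, g₀₀ μ + g₀₁; g₁₀ a, g₁₀ μ + g₁₁)` of
`[g] τ_μ δ_a`: its trace. [folklore] -/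
theorem trace_mul_upperRightHom_mul_diagGL (g : GL (Fin 2) k) (μ : k) (a : kˣ) :
    ((g * Matrix.GeneralLinearGroup.upperRightHom μ * diagGL a : GL (Fin 2) k) : M₂).trace =
      g 0 0 * a + g 1 0 * μ + g 1 1 := by
  rw [Units.val_mul, Units.val_mul, diagGL_val, Matrix.trace_fin_two]
  simp [Matrix.GeneralLinearGroup.upperRightHom_apply, Matrix.mul_apply, Fin.sum_univ_two]
  ring

/-- … and its determinant `a det g`. [folklore] -/
theorem det_mul_upperRightHom_mul_diagGL (g : GL (Fin 2) k) (μ : k) (a : kˣ) :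
    ((g * Matrix.GeneralLinearGroup.upperRightHom μ * diagGL a : GL (Fin 2) k) : M₂).det =
      (g : M₂).det * a := by
  rw [Units.val_mul, Units.val_mul, det_mul, det_mul, diagGL_val]
  simp [Matrix.GeneralLinearGroup.upperRightHom_apply, Matrix.det_fin_two_of]

/-- **The quadratic in `μ`**: `(g₁₀ X + (g₀₀ a + g₁₁))² - 4 a det g`, whose roots are the `μ`
with `[g] τ_μ δ_a` a `p`-element (Faber 2011, (6.0.3): "`(α_i λ + γ_i μ + δ_i)² = 4λ det(s_i)`.
For fixed `s_i` and `λ`, there are precisely `ε_p` values of `μ`"). [cite: Faber2011, Lemma 6.3] -/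
noncomputable def cosetQuad (g : GL (Fin 2) k) (a : kˣ) : Polynomial k :=
  Polynomial.C (g 1 0 ^ 2) * Polynomial.X ^ 2 +
    Polynomial.C (2 * g 1 0 * (g 0 0 * a + g 1 1)) * Polynomial.X +
    Polynomial.C ((g 0 0 * a + g 1 1) ^ 2 - 4 * ((g : M₂).det * a))

/-- The linear form `g₁₀ X + (g₀₀ a + g₁₁)` (relevant in characteristic `2`, where
`cosetQuad = cosetLin²`). [cite: Faber2011, Lemma 6.3] -/
noncomputable def cosetLin (g : GL (Fin 2) k) (a : kˣ) : Polynomial k :=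
  Polynomial.C (g 1 0) * Polynomial.X + Polynomial.C (g 0 0 * a + g 1 1)

/-- Evaluating `cosetQuad`. [folklore] -/
theorem eval_cosetQuad (g : GL (Fin 2) k) (a : kˣ) (μ : k) :
    (cosetQuad g a).eval μ = (g 0 0 * a + g 1 0 * μ + g 1 1) ^ 2 - 4 * ((g : M₂).det * a) := by
  simp only [cosetQuad, Polynomial.eval_add, Polynomial.eval_mul, Polynomial.eval_C,
    Polynomial.eval_pow, Polynomial.eval_X]
  ring

/-- Evaluating `cosetLin`. [folklore] -/
theorem eval_cosetLin (g : GL (Fin 2) k) (a : kˣ) (μ : k) :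
    (cosetLin g a).eval μ = g 0 0 * a + g 1 0 * μ + g 1 1 := by
  simp only [cosetLin, Polynomial.eval_add, Polynomial.eval_mul, Polynomial.eval_C,
    Polynomial.eval_X]
  ring

/-- `cosetQuad` has degree `≤ 2`. [folklore] -/
theorem natDegree_cosetQuad_le (g : GL (Fin 2) k) (a : kˣ) : (cosetQuad g a).natDegree ≤ 2 := by
  unfold cosetQuad
  compute_degree

/-- `cosetLin` has degree `≤ 1`. [folklore] -/
theorem natDegree_cosetLin_le (g : GL (Fin 2) k) (a : kˣ) : (cosetLin g a).natDegree ≤ 1 := by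
  unfold cosetLin
  compute_degree

/-- `cosetQuad ≠ 0` when `g₁₀ ≠ 0` (i.e. `[g]` does not fix `∞`). [folklore] -/
theorem cosetQuad_ne_zero {g : GL (Fin 2) k} (hg : g 1 0 ≠ 0) (a : kˣ) : cosetQuad g a ≠ 0 := by
  intro h
  have := congrArg (Polynomial.coeff · 2) h
  simp only [cosetQuad, Polynomial.coeff_add, Polynomial.coeff_C_mul_X_pow,
    Polynomial.coeff_C_mul_X, Polynomial.coeff_C, Polynomial.coeff_zero] at this
  simp at this
  exact hg this

/-- `cosetLin ≠ 0` when `g₁₀ ≠ 0`. [folklore] -/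
theorem cosetLin_ne_zero {g : GL (Fin 2) k} (hg : g 1 0 ≠ 0) (a : kˣ) : cosetLin g a ≠ 0 := by
  intro h
  have := congrArg (Polynomial.coeff · 1) h
  simp only [cosetLin, Polynomial.coeff_add, Polynomial.coeff_C_mul_X, Polynomial.coeff_C,
    Polynomial.coeff_zero] at this
  simp at this
  exact hg this

/-- A finite set of roots of a non-zero polynomial has at most `natDegree` elements. [folklore] -/
theorem card_le_natDegree_of_forall_eval_eq_zero {P : Polynomial k} (hP : P ≠ 0) {F : Finset k}
    (hF : ∀ μ ∈ F, P.eval μ = 0) : F.card ≤ P.natDegree := by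
  classical
  calc F.card ≤ P.roots.toFinset.card := by
        refine Finset.card_le_card fun μ hμ => ?_
        rw [Multiset.mem_toFinset, Polynomial.mem_roots hP]
        exact hF μ hμ
    _ ≤ Multiset.card P.roots := Multiset.toFinset_card_le _
    _ ≤ P.natDegree := Polynomial.card_roots' P

variable [DecidableEq k] (p : ℕ) [Fact p.Prime] [CharP k p]

omit [DecidableEq k] in
/-- **The trace condition along a coset**: for `[g]` not fixing `∞`, `[g] τ_μ δ_a` is a
`p`-element (or `1`) iff `μ` is a root of `cosetQuad g a` (Faber 2011, (6.0.3)).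
[cite: Faber2011, Lemma 6.3] -/
theorem mk_mul_transl_mul_homoth_pow_char_eq_one_iff [IsAlgClosed k] (g : GL (Fin 2) k) (μ : k)
    (a : kˣ) : (Matrix.ProjGenLinGroup.mk g * transl μ * homoth a) ^ p = 1 ↔
      (cosetQuad g a).eval μ = 0 := by
  rw [transl_apply, homoth_apply, ← map_mul, ← map_mul, mk_pow_char_eq_one_iff_trace_sq p,
    trace_mul_upperRightHom_mul_diagGL, det_mul_upperRightHom_mul_diagGL, eval_cosetQuad, sub_eq_zero]

omit [DecidableEq k] in
/-- In characteristic `2`, `cosetQuad = cosetLin²` on values. [folklore] -/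
theorem eval_cosetQuad_of_two (hp : p = 2) (g : GL (Fin 2) k) (a : kˣ) (μ : k) :
    (cosetQuad g a).eval μ = ((cosetLin g a).eval μ) ^ 2 := by
  have h4 : (4 : k) = 0 := by
    have : ((4 : ℕ) : k) = 0 := by
      rw [show (4 : ℕ) = 2 * 2 from rfl, Nat.cast_mul]
      subst hp
      rw [CharP.cast_eq_zero, zero_mul]
    exact_mod_cast this
  rw [eval_cosetQuad, eval_cosetLin, h4, zero_mul, sub_zero]

omit [DecidableEq k] in
/-- **At most `ε_p` roots**: a finite set of `μ` making `[g] τ_μ δ_a` a `p`-element has at most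
`2` elements, and at most `1` in characteristic `2` (`ε_2 = 1`, `ε_p = 2` for `p ≥ 3`).
[cite: Faber2011, Lemma 6.3] -/
theorem card_le_eps_of_forall_pow_char_eq_one [IsAlgClosed k] {g : GL (Fin 2) k} (hg : g 1 0 ≠ 0)
    (a : kˣ) {F : Finset k}
    (hF : ∀ μ ∈ F, (Matrix.ProjGenLinGroup.mk g * transl μ * homoth a) ^ p = 1) :
    F.card ≤ if p = 2 then 1 else 2 := by
  split_ifs with hp
  · refine le_trans (card_le_natDegree_of_forall_eval_eq_zero (cosetLin_ne_zero hg a) ?_)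
      (natDegree_cosetLin_le g a)
    intro μ hμ
    have h := (mk_mul_transl_mul_homoth_pow_char_eq_one_iff p g μ a).mp (hF μ hμ)
    rw [eval_cosetQuad_of_two p hp] at h
    exact pow_eq_zero_iff two_ne_zero |>.mp h
  · refine le_trans (card_le_natDegree_of_forall_eval_eq_zero (cosetQuad_ne_zero hg a) ?_)
      (natDegree_cosetQuad_le g a)
    intro μ hμ
    exact (mk_mul_transl_mul_homoth_pow_char_eq_one_iff p g μ a).mp (hF μ hμ)

end CosetCount

section PerCoset

variable [DecidableEq k] (p : ℕ) [Fact p.Prime] [CharP k p]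
variable (H : Subgroup PGL(Fin 2, k)) [Finite H]

omit [Fact (Nat.Prime p)] [CharP k p] [Finite H] in
/-- Elements of `Stab_H(∞)` fix `∞` (coercion form). [folklore] -/
theorem coe_stabilizer_smul_infty (n : stabilizer H (∞ : OnePoint k)) :
    ((n : H) : PGL(Fin 2, k)) • (∞ : OnePoint k) = ∞ := by
  have := n.2
  rwa [mem_stabilizer_iff, Subgroup.smul_def] at this

/-- **At most `ε_p` `p`-elements per coset and multiplier** (`k` algebraically closed of
characteristic `p`): for `s` not fixing `∞` and a fixed multiplier `l`, the `n ∈ Stab_H(∞)` with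
`n'(∞) = l` and `(s n)^p = 1` number at most `ε_p` (`ε_2 = 1`, `ε_p = 2` otherwise) — their
translation parts are roots of `cosetQuad` (Faber 2011, proof of Lemma 6.3: "For fixed `s_i` and
`λ`, there are precisely `ε_p` values of `μ ∈ k` so that (6.0.3) is satisfied").
[cite: Faber2011, Lemma 6.3] -/
theorem card_fibre_le [IsAlgClosed k] {s : PGL(Fin 2, k)} (hs : s • (∞ : OnePoint k) ≠ ∞) (l : kˣ) :
    Nat.card {n : stabilizer H (∞ : OnePoint k) //
      (stabDeriv H n : kˣ) = l ∧ (s * ((n : H) : PGL(Fin 2, k))) ^ p = 1} ≤ if p = 2 then 1 else 2 := by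
  classical
  set S := stabilizer H (∞ : OnePoint k) with hSdef
  haveI : Fintype S := Fintype.ofFinite _
  obtain ⟨g, rfl⟩ := Matrix.ProjGenLinGroup.mk_surjective s
  have hg : g 1 0 ≠ 0 := by rwa [Ne, mk_smul_infty_eq_self_iff] at hs
  set A : Finset S := Finset.univ.filter (fun n => (stabDeriv H n : kˣ) = l ∧
    (Matrix.ProjGenLinGroup.mk g * ((n : H) : PGL(Fin 2, k))) ^ p = 1) with hA
  rw [Nat.card_eq_fintype_card, Fintype.card_subtype]
  have hinj : Set.InjOn (fun n : S => shiftInfty ((n : H) : PGL(Fin 2, k))) ↑A := by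
    intro n hn n' hn' hnn'
    rw [Finset.coe_filter, Set.mem_setOf_eq] at hn hn'
    have hd : derivInfty ((n : H) : PGL(Fin 2, k)) = derivInfty ((n' : H) : PGL(Fin 2, k)) := by
      have := congrArg (fun u : kˣ => (u : k)) (hn.2.1.trans hn'.2.1.symm)
      simpa using this
    exact Subtype.ext (Subtype.ext (eq_of_derivInfty_eq_of_shiftInfty_eq
      (coe_stabilizer_smul_infty H n) (coe_stabilizer_smul_infty H n') hd hnn'))
  rw [← Finset.card_image_of_injOn hinj]
  refine card_le_eps_of_forall_pow_char_eq_one p hg l ?_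
  intro μ hμ
  obtain ⟨n, hn, rfl⟩ := Finset.mem_image.mp hμ
  simp only [Finset.mem_filter, hA, Finset.mem_univ, true_and] at hn
  obtain ⟨hnl, hnp⟩ := hn
  have hdecomp := eq_transl_shiftInfty_mul_homoth (coe_stabilizer_smul_infty H n)
  have hunit : Units.mk0 (derivInfty ((n : H) : PGL(Fin 2, k)))
      (derivInfty_ne_zero (coe_stabilizer_smul_infty H n)) = l := by
    rw [← hnl]
    exact Units.ext rfl
  rw [hunit] at hdecomp
  rw [mul_assoc, ← hdecomp]
  exact hnp

open scoped Classical in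
omit [Fact (Nat.Prime p)] [CharP k p] in
/-- Decomposing the `p`-elements of a coset `s · Stab_H(∞)` according to the multiplier.
[folklore] -/
theorem card_mul_pow_eq_one_eq_sum [Fintype (Lambda H)] (s : PGL(Fin 2, k)) :
    Nat.card {n : stabilizer H (∞ : OnePoint k) // (s * ((n : H) : PGL(Fin 2, k))) ^ p = 1} =
      ∑ l : Lambda H, Nat.card {n : stabilizer H (∞ : OnePoint k) //
        (stabDeriv H n : kˣ) = l ∧ (s * ((n : H) : PGL(Fin 2, k))) ^ p = 1} := by
  set S := stabilizer H (∞ : OnePoint k) with hSdef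
  haveI : Fintype S := Fintype.ofFinite _
  set A : Finset S := Finset.univ.filter (fun n => (s * ((n : H) : PGL(Fin 2, k))) ^ p = 1) with hA
  rw [Nat.card_eq_fintype_card, Fintype.card_subtype]
  set f : S → Lambda H := fun n => ⟨stabDeriv H n, ⟨n, rfl⟩⟩ with hf
  rw [Finset.card_eq_sum_card_fiberwise (f := f) (s := A) (t := Finset.univ)
    (fun _ _ => Finset.mem_coe.mpr (Finset.mem_univ _))]
  refine Finset.sum_congr rfl fun l _ => ?_
  rw [Nat.card_eq_fintype_card, Fintype.card_subtype, hA, Finset.filter_filter]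
  congr 1
  ext n
  simp only [Finset.mem_filter, Finset.mem_univ, true_and, hf]
  constructor
  · rintro ⟨h1, h2⟩
    exact ⟨by rw [← h2], h1⟩
  · rintro ⟨h1, h2⟩
    exact ⟨h2, Subtype.ext h1⟩

/-- **At most `ε_p |Λ|` `p`-elements in a coset of the stabiliser of `∞`** (Faber 2011, proof of
Lemma 6.3: "for a given `s_i`, there are at most `ε_p d` elements `t_{λ,μ} ∈ N` such that (6.0.3)
is satisfied"). [cite: Faber2011, Lemma 6.3] -/
theorem card_stabilizer_mul_pow_char_eq_one_le [IsAlgClosed k] {s : PGL(Fin 2, k)}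
    (hs : s • (∞ : OnePoint k) ≠ ∞) :
    Nat.card {n : stabilizer H (∞ : OnePoint k) // (s * ((n : H) : PGL(Fin 2, k))) ^ p = 1} ≤
      (if p = 2 then 1 else 2) * Nat.card (Lambda H) := by
  classical
  haveI : Finite (Lambda H) := Finite.of_surjective _ (stabDeriv H).rangeRestrict_surjective
  haveI : Fintype (Lambda H) := Fintype.ofFinite _
  rw [card_mul_pow_eq_one_eq_sum p H s]
  calc ∑ l : Lambda H, Nat.card {n : stabilizer H (∞ : OnePoint k) //
          (stabDeriv H n : kˣ) = l ∧ (s * ((n : H) : PGL(Fin 2, k))) ^ p = 1}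
      ≤ (Finset.univ : Finset (Lambda H)).card • (if p = 2 then 1 else 2) :=
        Finset.sum_le_card_nsmul _ _ _ (fun l _ => card_fibre_le p H hs l)
    _ = (if p = 2 then 1 else 2) * Nat.card (Lambda H) := by
        rw [smul_eq_mul, Finset.card_univ, ← Nat.card_eq_fintype_card, mul_comm]

end PerCoset

section Global

variable [DecidableEq k] (p : ℕ) [Fact p.Prime] [CharP k p]
variable (H : Subgroup PGL(Fin 2, k)) [Finite H]

/-- **Any two distinct Sylow `p`-subgroups meet trivially** (from `sylow_inf_eq_bot` by
conjugation). [cite: Faber2011, §6, first paragraph] -/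
theorem sylow_inf_eq_bot_of_ne [IsAlgClosed k] (P : Sylow p H) (hP1 : (P : Subgroup H) ≠ ⊥)
    (hPi : (P : Subgroup H) ≤ stabilizer H (∞ : OnePoint k)) {Q Q' : Sylow p H} (hne : Q ≠ Q') :
    (Q : Subgroup H) ⊓ Q' = ⊥ := by
  obtain ⟨g, rfl⟩ := MulAction.exists_smul_eq H P Q
  have hne' : g⁻¹ • Q' ≠ P := by
    intro h
    apply hne
    rw [← h, smul_inv_smul]
  have h1 := sylow_inf_eq_bot p H P (g⁻¹ • Q') hP1 hPi hne'
  have : ((g • P : Sylow p H) : Subgroup H) ⊓ (Q' : Subgroup H) =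
      MulAut.conj g • ((P : Subgroup H) ⊓ ((g⁻¹ • Q' : Sylow p H) : Subgroup H)) := by
    rw [Subgroup.smul_inf, ← Sylow.coe_subgroup_smul, ← Sylow.coe_subgroup_smul, smul_inv_smul]
  rw [this, h1, Subgroup.smul_bot]

omit [Finite H] [DecidableEq k] in
/-- Elements of a Sylow `p`-subgroup are `p`-elements (no elements of order `p²`).
[cite: Faber2011, Prop. 4.1] -/
theorem pow_char_eq_one_of_mem_sylow [IsAlgClosed k] (Q : Sylow p H) {h : H} (hh : h ∈ (Q : Subgroup H)) :
    h ^ p = 1 := by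
  obtain ⟨m, hm⟩ := Q.isPGroup' ⟨h, hh⟩
  have h1 : (h : PGL(Fin 2, k)) ^ p ^ m = 1 := by
    simpa using congrArg (fun t : (Q : Subgroup H) => ((t : H) : PGL(Fin 2, k))) hm
  exact Subtype.ext (by
    rw [Subgroup.coe_pow, Subgroup.coe_one]
    exact pow_char_eq_one_of_pow_char_pow_eq_one p h1)

omit [Finite H] [DecidableEq k] [CharP k p] [Fact (Nat.Prime p)] in
/-- A `p`-element generates a `p`-group. [folklore] -/
theorem isPGroup_zpowers_of_pow_eq_one {h : H} (hh : h ^ p = 1) : IsPGroup p (Subgroup.zpowers h) := by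
  rintro ⟨x, hx⟩
  obtain ⟨i, rfl⟩ := Subgroup.mem_zpowers_iff.mp hx
  refine ⟨1, Subtype.ext ?_⟩
  rw [pow_one, Subgroup.coe_pow, Subgroup.coe_one, ← zpow_natCast, ← zpow_mul, mul_comm,
    zpow_mul, zpow_natCast, hh, one_zpow]

omit [Finite H] in
/-- A `p`-element fixing `∞` lies in the Sylow `p`-subgroup fixing `∞`. [folklore] -/
theorem mem_sylow_of_pow_eq_one_of_mem_stabilizer (P : Sylow p H)
    (hPi : (P : Subgroup H) ≤ stabilizer H (∞ : OnePoint k)) {h : H} (hh : h ^ p = 1)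
    (hhS : h ∈ stabilizer H (∞ : OnePoint k)) : h ∈ (P : Subgroup H) := by
  rw [sylow_eq_translSubgroup p H P hPi]
  refine le_translSubgroup_of_isPGroup p H (isPGroup_zpowers_of_pow_eq_one p H hh) ?_
    (Subgroup.mem_zpowers h)
  exact (Subgroup.zpowers_le).mpr hhS

/-- The number of Sylow `p`-subgroups is `[H : Stab_H(∞)]`. [cite: Faber2011, §6, (6.0.2)] -/
theorem card_sylow_eq_index [IsAlgClosed k] (P : Sylow p H) (hP1 : (P : Subgroup H) ≠ ⊥)
    (hPi : (P : Subgroup H) ≤ stabilizer H (∞ : OnePoint k)) :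
    Nat.card (Sylow p H) = (stabilizer H (∞ : OnePoint k)).index := by
  rw [P.card_eq_index_normalizer]
  change (Subgroup.normalizer ((P : Subgroup H) : Set H)).index = _
  rw [sylow_normalizer_eq_stabilizer p H P hP1 hPi]

/-- **Lower count of `p`-elements off the stabiliser**: with `n_p` Sylow `p`-subgroups of order
`q`, at least `(n_p - 1)(q - 1)` `p`-elements of `H` do not fix `∞` (the non-identity elements of
the Sylow subgroups `Q ≠ P`, which are disjoint; Faber 2011, (6.0.1): "the elements of order `p` lie
in `1 + f p^m` conjugate Sylow `p`-subgroups"). [cite: Faber2011, Lemma 6.3, (6.0.1)] -/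
theorem card_sylow_sub_one_mul_le_card [IsAlgClosed k] (P : Sylow p H)
    (hP1 : (P : Subgroup H) ≠ ⊥) (hPi : (P : Subgroup H) ≤ stabilizer H (∞ : OnePoint k)) :
    ((stabilizer H (∞ : OnePoint k)).index - 1) * (Nat.card (P : Subgroup H) - 1) ≤
      Nat.card {h : H // h ^ p = 1 ∧ h ∉ stabilizer H (∞ : OnePoint k)} := by
  classical
  rw [← card_sylow_eq_index p H P hP1 hPi]
  haveI : Fintype H := Fintype.ofFinite H
  set S := stabilizer H (∞ : OnePoint k) with hS
  set T := Finset.univ.filter (fun h : H => h ^ p = 1 ∧ h ∉ S) with hT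
  have hTcard : Nat.card {h : H // h ^ p = 1 ∧ h ∉ S} = T.card := by
    rw [Nat.card_eq_fintype_card, Fintype.card_subtype]
  rw [hTcard]
  haveI : Fintype (Sylow p H) := Fintype.ofFinite _
  let B : {Q : Sylow p H // Q ≠ P} → Finset H :=
    fun Q => (Finset.univ.filter (fun h : H => h ∈ ((Q : Sylow p H) : Subgroup H))).erase 1
  have hBsub : ∀ Q, B Q ⊆ T := by
    intro Q h hh
    rw [Finset.mem_erase, Finset.mem_filter] at hh
    obtain ⟨h1, -, hQ⟩ := hh
    rw [hT, Finset.mem_filter]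
    refine ⟨Finset.mem_univ _, pow_char_eq_one_of_mem_sylow p H Q hQ, fun hhS => h1 ?_⟩
    have hP := mem_sylow_of_pow_eq_one_of_mem_stabilizer p H P hPi (pow_char_eq_one_of_mem_sylow p H Q hQ) hhS
    have : h ∈ (P : Subgroup H) ⊓ (Q : Sylow p H) := ⟨hP, hQ⟩
    rwa [sylow_inf_eq_bot_of_ne p H P hP1 hPi (Ne.symm Q.2), Subgroup.mem_bot] at this
  have hBdisj : Set.PairwiseDisjoint (↑(Finset.univ : Finset {Q : Sylow p H // Q ≠ P})) B := by
    intro Q _ Q' _ hQQ'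
    rw [Function.onFun, Finset.disjoint_left]
    intro h hh hh'
    rw [Finset.mem_erase, Finset.mem_filter] at hh hh'
    apply hh.1
    have : h ∈ ((Q : Sylow p H) : Subgroup H) ⊓ ((Q' : Sylow p H) : Subgroup H) := ⟨hh.2.2, hh'.2.2⟩
    rwa [sylow_inf_eq_bot_of_ne p H P hP1 hPi (fun heq => hQQ' (Subtype.ext heq)),
      Subgroup.mem_bot] at this
  have hBcard : ∀ Q, (B Q).card = Nat.card (P : Subgroup H) - 1 := by
    intro Q
    have h1 : (1 : H) ∈ Finset.univ.filter (fun h : H => h ∈ ((Q : Sylow p H) : Subgroup H)) := by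
      simp
    rw [Finset.card_erase_of_mem h1]
    congr 1
    rw [← Fintype.card_subtype, ← Nat.card_eq_fintype_card]
    exact (Sylow.card_eq_multiplicity (Q : Sylow p H)).trans (Sylow.card_eq_multiplicity P).symm
  have hι : (Finset.univ : Finset {Q : Sylow p H // Q ≠ P}).card = Nat.card (Sylow p H) - 1 := by
    rw [Finset.card_univ, Fintype.card_of_subtype (Finset.univ.erase P) (fun Q => by simp),
      Finset.card_erase_of_mem (Finset.mem_univ P), Finset.card_univ, Nat.card_eq_fintype_card]
  calc (Nat.card (Sylow p H) - 1) * (Nat.card (P : Subgroup H) - 1)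
      = ∑ Q : {Q : Sylow p H // Q ≠ P}, (B Q).card := by
        rw [Finset.sum_congr rfl (fun Q _ => hBcard Q), Finset.sum_const, smul_eq_mul, hι]
    _ = (Finset.univ.biUnion B).card := (Finset.card_biUnion hBdisj).symm
    _ ≤ T.card := Finset.card_le_card (Finset.biUnion_subset.mpr fun Q _ => hBsub Q)

open scoped Classical in
omit [Fact (Nat.Prime p)] [CharP k p] in
/-- **Upper count of `p`-elements off the stabiliser, along a system of coset
representatives** `σ`: they are distributed among the non-trivial cosets `c = σ(c) Stab_H(∞)`
(Faber 2011, proof of Lemma 6.3, (6.0.3)). [cite: Faber2011, Lemma 6.3] -/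
theorem card_le_sum_section [Fintype (H ⧸ stabilizer H (∞ : OnePoint k))]
    (σ : H ⧸ stabilizer H (∞ : OnePoint k) → H) (hσ : ∀ c, (σ c : H ⧸ stabilizer H (∞ : OnePoint k)) = c) :
    Nat.card {h : H // h ^ p = 1 ∧ h ∉ stabilizer H (∞ : OnePoint k)} ≤
      ∑ c ∈ Finset.univ.erase ((1 : H) : H ⧸ stabilizer H (∞ : OnePoint k)),
        Nat.card {n : stabilizer H (∞ : OnePoint k) //
          (((σ c : H) : PGL(Fin 2, k)) * ((n : H) : PGL(Fin 2, k))) ^ p = 1} := by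
  haveI : Fintype H := Fintype.ofFinite H
  set T := Finset.univ.filter (fun h : H => h ^ p = 1 ∧ h ∉ stabilizer H (∞ : OnePoint k)) with hT
  have hTcard : Nat.card {h : H // h ^ p = 1 ∧ h ∉ stabilizer H (∞ : OnePoint k)} = T.card := by
    rw [Nat.card_eq_fintype_card, Fintype.card_subtype]
  rw [hTcard]
  haveI : Fintype (stabilizer H (∞ : OnePoint k)) := Fintype.ofFinite _
  have hmaps : (↑T : Set H).MapsTo (QuotientGroup.mk : H → H ⧸ stabilizer H (∞ : OnePoint k))
      ↑(Finset.univ.erase ((1 : H) : H ⧸ stabilizer H (∞ : OnePoint k))) := by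
    intro h hh
    rw [Finset.mem_coe, hT, Finset.mem_filter] at hh
    rw [Finset.mem_coe, Finset.mem_erase]
    refine ⟨fun heq => hh.2.2 ?_, Finset.mem_univ _⟩
    rw [QuotientGroup.eq, mul_one] at heq
    exact (inv_mem_iff (x := h)).mp heq
  rw [Finset.card_eq_sum_card_fiberwise hmaps]
  apply Finset.sum_le_sum
  intro c hc
  set s : H := σ c with hsdef
  have hsc : (s : H ⧸ stabilizer H (∞ : OnePoint k)) = c := hσ c
  let A : Finset (stabilizer H (∞ : OnePoint k)) := Finset.univ.filter
    (fun n => ((s : PGL(Fin 2, k)) * ((n : H) : PGL(Fin 2, k))) ^ p = 1)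
  have hA : A.card = Nat.card {n : stabilizer H (∞ : OnePoint k) //
      ((s : PGL(Fin 2, k)) * ((n : H) : PGL(Fin 2, k))) ^ p = 1} := by
    rw [Nat.card_eq_fintype_card, Fintype.card_subtype]
  have hsub : T.filter (fun h => (QuotientGroup.mk h : H ⧸ stabilizer H (∞ : OnePoint k)) = c) ⊆
      A.image (fun n : stabilizer H (∞ : OnePoint k) => s * (n : H)) := by
    intro h hh
    rw [Finset.mem_filter, hT, Finset.mem_filter] at hh
    have hm : s⁻¹ * h ∈ stabilizer H (∞ : OnePoint k) := by
      rw [← QuotientGroup.eq]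
      exact hsc.trans hh.2.symm
    rw [Finset.mem_image]
    refine ⟨⟨s⁻¹ * h, hm⟩, ?_, mul_inv_cancel_left s h⟩
    simp only [A, Finset.mem_filter, Finset.mem_univ, true_and]
    rw [Subgroup.coe_mul, Subgroup.coe_inv, mul_inv_cancel_left, ← Subgroup.coe_pow, hh.1.2.1,
      Subgroup.coe_one]
  calc (T.filter (fun h => (QuotientGroup.mk h : H ⧸ stabilizer H (∞ : OnePoint k)) = c)).card
      ≤ (A.image (fun n : stabilizer H (∞ : OnePoint k) => s * (n : H))).card := Finset.card_le_card hsub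
    _ ≤ A.card := Finset.card_image_le
    _ = _ := hA

omit [Fact (Nat.Prime p)] [CharP k p] [Finite H] in
/-- A coset representative of a non-trivial coset does not fix `∞`. [folklore] -/
theorem smul_infty_ne_of_mk_ne_one {s : H}
    (hs : (s : H ⧸ stabilizer H (∞ : OnePoint k)) ≠ ((1 : H) : H ⧸ stabilizer H (∞ : OnePoint k))) :
    (s : PGL(Fin 2, k)) • (∞ : OnePoint k) ≠ ∞ := by
  intro h
  apply hs
  rw [QuotientGroup.eq, mul_one]
  exact inv_mem (show s ∈ stabilizer H (∞ : OnePoint k) by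
    rw [mem_stabilizer_iff, Subgroup.smul_def]; exact h)

/-- **Upper count of `p`-elements off the stabiliser**: at most `([H : Stab_H(∞)] - 1) ε_p |Λ|`
(Faber 2011, proof of Lemma 6.3: "`(1 + f p^m)(p^m - 1) ≤ (p^m - 1) + ε_p d f p^m`").
[cite: Faber2011, Lemma 6.3] -/
theorem card_le_index_sub_one_mul [IsAlgClosed k] :
    Nat.card {h : H // h ^ p = 1 ∧ h ∉ stabilizer H (∞ : OnePoint k)} ≤
      ((stabilizer H (∞ : OnePoint k)).index - 1) * ((if p = 2 then 1 else 2) * Nat.card (Lambda H)) := by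
  classical
  haveI : Fintype (H ⧸ stabilizer H (∞ : OnePoint k)) := Fintype.ofFinite _
  refine (card_le_sum_section p H Quotient.out (fun c => QuotientGroup.out_eq' c)).trans ?_
  calc ∑ c ∈ Finset.univ.erase ((1 : H) : H ⧸ stabilizer H (∞ : OnePoint k)),
        Nat.card {n : stabilizer H (∞ : OnePoint k) //
          (((c.out : H) : PGL(Fin 2, k)) * ((n : H) : PGL(Fin 2, k))) ^ p = 1}
      ≤ (Finset.univ.erase ((1 : H) : H ⧸ stabilizer H (∞ : OnePoint k))).card •
          ((if p = 2 then 1 else 2) * Nat.card (Lambda H)) := by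
        refine Finset.sum_le_card_nsmul _ _ _ fun c hc => ?_
        refine card_stabilizer_mul_pow_char_eq_one_le p H (smul_infty_ne_of_mk_ne_one H ?_)
        rw [QuotientGroup.out_eq']
        exact (Finset.mem_erase.mp hc).1
    _ = _ := by
        rw [smul_eq_mul, Finset.card_erase_of_mem (Finset.mem_univ _), Finset.card_univ,
          Subgroup.index, ← Nat.card_eq_fintype_card]

/-- **Faber's Lemma 6.3 (the inequality `q - 1 ≤ ε_p d`)**: let `k` be algebraically closed of
characteristic `p`, `H ≤ PGL₂(k)` finite with a Sylow `p`-subgroup `P ≠ 1` of order `q` fixing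
`∞`, not normal (i.e. `H` does not fix `∞`), and let `d = |Λ(H)|` be the number of multipliers.
Then `q - 1 ≤ ε_p d` with `ε_2 = 1`, `ε_p = 2` for `p` odd (Faber 2011, (6.0.4):
"`f p^m (p^m - 1) ≤ ε_p d f p^m ⇒ p^m - 1 ≤ ε_p d`"). [cite: Faber2011, Lemma 6.3, (6.0.4)] -/
theorem card_sylow_sub_one_le [IsAlgClosed k] (P : Sylow p H) (hP1 : (P : Subgroup H) ≠ ⊥)
    (hPi : (P : Subgroup H) ≤ stabilizer H (∞ : OnePoint k))
    (hS : stabilizer H (∞ : OnePoint k) ≠ ⊤) :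
    Nat.card (P : Subgroup H) - 1 ≤ (if p = 2 then 1 else 2) * Nat.card (Lambda H) := by
  have h1 := card_sylow_sub_one_mul_le_card p H P hP1 hPi
  have h2 := card_le_index_sub_one_mul p H
  have hlt : 1 < (stabilizer H (∞ : OnePoint k)).index := Subgroup.one_lt_index_of_ne_top hS
  exact Nat.le_of_mul_le_mul_left (h1.trans h2) (by omega)

/-- **The equality case of Lemma 6.3**: if `q - 1 = ε_p d`, then for every `s ∈ H` not fixing `∞`
and every multiplier `l ∈ Λ(H)` there are exactly — in particular at least — `ε_p` elements
`n ∈ Stab_H(∞)` with `n'(∞) = l` and `(s n)^p = 1` (Faber 2011, §6.1: "the first inequality of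
(6.0.4) is actually an equality, which implies that for each fixed coset representative `s_i`, and
each `λ ∈ Λ`, there are exactly `ε_p > 0` elements `μ ∈ 𝔽_q` satisfying (6.0.3)").
[cite: Faber2011, §6.1] -/
theorem eps_le_card_fibre_of_eq [IsAlgClosed k] (P : Sylow p H) (hP1 : (P : Subgroup H) ≠ ⊥)
    (hPi : (P : Subgroup H) ≤ stabilizer H (∞ : OnePoint k))
    (heq : Nat.card (P : Subgroup H) - 1 = (if p = 2 then 1 else 2) * Nat.card (Lambda H))
    {s : H} (hs : (s : PGL(Fin 2, k)) • (∞ : OnePoint k) ≠ ∞) {l : kˣ} (hl : l ∈ Lambda H) :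
    (if p = 2 then 1 else 2) ≤ Nat.card {n : stabilizer H (∞ : OnePoint k) //
      (stabDeriv H n : kˣ) = l ∧ ((s : PGL(Fin 2, k)) * ((n : H) : PGL(Fin 2, k))) ^ p = 1} := by
  classical
  set ε := (if p = 2 then 1 else 2) with hε
  set S := stabilizer H (∞ : OnePoint k) with hSdef
  haveI : Fintype (H ⧸ S) := Fintype.ofFinite _
  haveI : Finite (Lambda H) := Finite.of_surjective _ (stabDeriv H).rangeRestrict_surjective
  haveI : Fintype (Lambda H) := Fintype.ofFinite _
  by_contra hlt
  push Not at hlt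
  -- coset representatives: `s` for its own coset, `Quotient.out` elsewhere
  set c₀ : H ⧸ S := (s : H ⧸ S) with hc₀
  have hc₀1 : c₀ ≠ ((1 : H) : H ⧸ S) := by
    intro h
    apply hs
    rw [hc₀, QuotientGroup.eq, mul_one] at h
    have : s ∈ S := (inv_mem_iff (x := s)).mp h
    rwa [mem_stabilizer_iff, Subgroup.smul_def] at this
  let σ : H ⧸ S → H := fun c => if c = c₀ then s else c.out
  have hσ : ∀ c, (σ c : H ⧸ S) = c := by
    intro c
    by_cases h : c = c₀
    · rw [h, show σ c₀ = s from if_pos rfl, hc₀]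
    · rw [show σ c = c.out from if_neg h]
      exact QuotientGroup.out_eq' c
  have hσ₀ : σ c₀ = s := if_pos rfl
  have hup := card_le_sum_section p H σ hσ
  have hlow := card_sylow_sub_one_mul_le_card p H P hP1 hPi
  set d := Nat.card (Lambda H) with hd
  set t : Finset (H ⧸ S) := Finset.univ.erase ((1 : H) : H ⧸ S) with ht
  set f : H ⧸ S → ℕ := fun c =>
    Nat.card {n : S // (((σ c : H) : PGL(Fin 2, k)) * ((n : H) : PGL(Fin 2, k))) ^ p = 1} with hf
  -- each coset term is `≤ ε d`
  have hcos : ∀ c ∈ t, f c ≤ ε * d := by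
    intro c hc
    refine card_stabilizer_mul_pow_char_eq_one_le p H (smul_infty_ne_of_mk_ne_one H ?_)
    rw [hσ c]
    exact (Finset.mem_erase.mp hc).1
  -- the `c₀` term is `≤ ε d - 1`: its `l`-fibre is deficient
  have hc₀t : c₀ ∈ t := Finset.mem_erase.mpr ⟨hc₀1, Finset.mem_univ _⟩
  have hc₀s : f c₀ + 1 ≤ ε * d := by
    set g : Lambda H → ℕ := fun l' => Nat.card {n : S //
      (stabDeriv H n : kˣ) = l' ∧ ((s : PGL(Fin 2, k)) * ((n : H) : PGL(Fin 2, k))) ^ p = 1} with hg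
    have hfc₀ : f c₀ = ∑ l' : Lambda H, g l' := by
      rw [hf]
      simp only [hσ₀]
      exact card_mul_pow_eq_one_eq_sum p H (s : PGL(Fin 2, k))
    have hgle : ∀ l' : Lambda H, g l' ≤ ε := fun l' => card_fibre_le p H hs l'
    have hgl : g ⟨l, hl⟩ + 1 ≤ ε := hlt
    rw [hfc₀, ← Finset.add_sum_erase _ _ (Finset.mem_univ (⟨l, hl⟩ : Lambda H))]
    have hrest : ∑ x ∈ Finset.univ.erase (⟨l, hl⟩ : Lambda H), g x ≤
        (Finset.univ.erase (⟨l, hl⟩ : Lambda H)).card • ε :=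
      Finset.sum_le_card_nsmul _ _ _ (fun l' _ => hgle l')
    rw [Finset.card_erase_of_mem (Finset.mem_univ _), Finset.card_univ, ← Nat.card_eq_fintype_card,
      smul_eq_mul, ← hd, Nat.sub_one_mul] at hrest
    have hd1 : 1 ≤ d := Nat.card_pos
    have hεd : ε ≤ d * ε := Nat.le_mul_of_pos_left ε hd1
    rw [mul_comm ε d]
    omega
  -- sum the coset bounds
  have hsum : ∑ c ∈ t, f c + 1 ≤ t.card * (ε * d) := by
    rw [← Finset.add_sum_erase _ _ hc₀t]
    have hrest : ∑ x ∈ t.erase c₀, f x ≤ (t.erase c₀).card • (ε * d) :=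
      Finset.sum_le_card_nsmul _ _ _ (fun c hc => hcos c (Finset.mem_of_mem_erase hc))
    rw [Finset.card_erase_of_mem hc₀t, smul_eq_mul, Nat.sub_one_mul] at hrest
    have ht1 : 1 ≤ t.card := Finset.card_pos.mpr ⟨c₀, hc₀t⟩
    have hle1 : ε * d ≤ t.card * (ε * d) := Nat.le_mul_of_pos_left _ ht1
    omega
  -- compare with the lower bound
  have htcard : t.card = S.index - 1 := by
    rw [ht, Finset.card_erase_of_mem (Finset.mem_univ _), Finset.card_univ, Subgroup.index,
      ← Nat.card_eq_fintype_card]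
  rw [htcard] at hsum
  rw [heq] at hlow
  have hlow' : (S.index - 1) * (ε * d) ≤ Nat.card {h : H // h ^ p = 1 ∧ h ∉ S} := hlow
  have hup' : Nat.card {h : H // h ^ p = 1 ∧ h ∉ S} ≤ ∑ c ∈ t, f c := hup
  omega

end Global

section Consequences

variable [DecidableEq k] (p : ℕ) [Fact p.Prime] [CharP k p]
variable (H : Subgroup PGL(Fin 2, k)) [Finite H]

omit [DecidableEq k] in
/-- The elementary step `p^m - 1 ≤ 2 (p^ℓ - 1)`, `ℓ ≤ m` forces `m = ℓ` (Faber 2011, end of the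
proof of Lemma 6.3: "If `ℓ < m`, then this gives `p^{m-ℓ} < 2`, which is impossible").
[cite: Faber2011, Lemma 6.3] -/
theorem pow_eq_pow_of_pow_sub_one_le {m l : ℕ} (hlm : l ≤ m) (h : p ^ m - 1 ≤ 2 * (p ^ l - 1)) :
    m = l := by
  have pp : p.Prime := Fact.out
  by_contra hne
  have hlt : l < m := lt_of_le_of_ne hlm (Ne.symm hne)
  have h1 : p ^ l * p ≤ p ^ m := by
    rw [← pow_succ]
    exact Nat.pow_le_pow_right pp.pos hlt
  have h2 : 2 * p ^ l ≤ p ^ l * p := by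
    rw [mul_comm]
    exact Nat.mul_le_mul_left _ pp.two_le
  have h3 : 0 < p ^ l := pow_pos pp.pos l
  omega

omit [Finite H] in
/-- `Γ(H) ≠ 0` when a non-trivial Sylow `p`-subgroup fixes `∞`. [folklore] -/
theorem Gamma_ne_bot (P : Sylow p H) (hP1 : (P : Subgroup H) ≠ ⊥)
    (hPi : (P : Subgroup H) ≤ stabilizer H (∞ : OnePoint k)) : Gamma H ≠ ⊥ := by
  intro h
  apply hP1
  rw [sylow_eq_translSubgroup p H P hPi, ← Subgroup.card_eq_one, ← card_Gamma, h, AddSubgroup.card_bot]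

omit [Finite H] in
/-- `|Γ(H)| = |P|` when the Sylow `p`-subgroup `P` fixes `∞`. [folklore] -/
theorem card_Gamma_eq_card_sylow (P : Sylow p H) (hPi : (P : Subgroup H) ≤ stabilizer H (∞ : OnePoint k)) :
    Nat.card (Gamma H) = Nat.card (P : Subgroup H) := by
  rw [card_Gamma, sylow_eq_translSubgroup p H P hPi]

/-- **Faber's Lemma 6.3 (`ℓ = m`: the stabiliser field has order `q`)**: under the hypotheses of
`card_sylow_sub_one_le`, `|𝔽_{Γ(H)}| = |Γ(H)| = |P| = q` (Faber 2011, Lemma 6.3: "Since `ℓ ∣ m`,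
we must have `ℓ = m`. … Now `Γ = 𝔽_Γ = 𝔽_q`"). [cite: Faber2011, Lemma 6.3] -/
theorem card_stabField_eq [IsAlgClosed k] (P : Sylow p H) (hP1 : (P : Subgroup H) ≠ ⊥)
    (hPi : (P : Subgroup H) ≤ stabilizer H (∞ : OnePoint k))
    (hS : stabilizer H (∞ : OnePoint k) ≠ ⊤) :
    Nat.card (stabField (Gamma H)) = Nat.card (Gamma H) := by
  classical
  have pp : p.Prime := Fact.out
  have hΓ := Gamma_ne_bot p H P hP1 hPi
  haveI : Finite (stabField (Gamma H)) := finite_stabField hΓ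
  haveI : Fintype (stabField (Gamma H)) := Fintype.ofFinite _
  -- `|𝔽_Γ| = p^ℓ`, `|Γ| = |P| = p^m`
  obtain ⟨l, -, hl⟩ := FiniteField.card (stabField (Gamma H)) p
  rw [← Nat.card_eq_fintype_card] at hl
  have hm : Nat.card (Gamma H) = p ^ (Nat.card H).factorization p := by
    rw [card_Gamma_eq_card_sylow p H P hPi, Sylow.card_eq_multiplicity]
  set m := (Nat.card H).factorization p with hmdef
  -- `ℓ ≤ m` and `p^m - 1 ≤ 2 (p^ℓ - 1)`
  have hle : (l : ℕ) ≤ m := by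
    have := card_stabField_le hΓ
    rw [hl, hm] at this
    exact (Nat.pow_le_pow_iff_right pp.one_lt).mp this
  have hineq := card_sylow_sub_one_le p H P hP1 hPi hS
  have hd := card_Lambda_le hΓ
  rw [← card_Gamma_eq_card_sylow p H P hPi, hm] at hineq
  rw [hl] at hd
  have h2 : p ^ m - 1 ≤ 2 * (p ^ (l : ℕ) - 1) := by
    refine hineq.trans ?_
    calc (if p = 2 then 1 else 2) * Nat.card (Lambda H) ≤ 2 * Nat.card (Lambda H) := by
          apply Nat.mul_le_mul_right
          split_ifs <;> omega
      _ ≤ 2 * (p ^ (l : ℕ) - 1) := Nat.mul_le_mul_left 2 hd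
  rw [hl, hm, pow_eq_pow_of_pow_sub_one_le p hle h2]

/-- **`Γ = 𝔽_Γ β₀`**: under the hypotheses of `card_sylow_sub_one_le`, the translation part is a
line over its stabiliser field (Faber 2011, Lemma 6.3). [cite: Faber2011, Lemma 6.3] -/
theorem exists_mem_stabField_mul_eq [IsAlgClosed k] (P : Sylow p H) (hP1 : (P : Subgroup H) ≠ ⊥)
    (hPi : (P : Subgroup H) ≤ stabilizer H (∞ : OnePoint k))
    (hS : stabilizer H (∞ : OnePoint k) ≠ ⊤) {β₀ : k} (hβ₀ : β₀ ∈ Gamma H) (h0 : β₀ ≠ 0)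
    {β : k} (hβ : β ∈ Gamma H) : ∃ α ∈ stabField (Gamma H), α * β₀ = β :=
  exists_eq_mul_of_card_stabField_eq hβ₀ h0 (card_stabField_eq p H P hP1 hPi hS) hβ

/-- **Normalised form `Γ = 𝔽_q`**: if moreover `1 ∈ Γ(H)`, then `Γ(H)` *is* the finite subfield
`𝔽_{Γ(H)}` of `k`, of order `q = |P|` (Faber 2011, Lemma 6.3 (2): "`G` contains the Sylow
`p`-subgroup `(1 𝔽_q; 0 1)`"). [cite: Faber2011, Lemma 6.3] -/
theorem coe_Gamma_eq_stabField [IsAlgClosed k] (P : Sylow p H) (hP1 : (P : Subgroup H) ≠ ⊥)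
    (hPi : (P : Subgroup H) ≤ stabilizer H (∞ : OnePoint k))
    (hS : stabilizer H (∞ : OnePoint k) ≠ ⊤) (h1 : (1 : k) ∈ Gamma H) :
    (Gamma H : Set k) = stabField (Gamma H) := by
  ext β
  constructor
  · intro hβ
    obtain ⟨α, hα, rfl⟩ := exists_mem_stabField_mul_eq p H P hP1 hPi hS h1 one_ne_zero hβ
    rw [mul_one]
    exact hα
  · intro hβ
    have := (mem_stabField_iff.mp hβ) 1 h1
    rwa [mul_one] at this

/-- **`Λ ↪ 𝔽_Γˣ` and `|Λ| ∣ |𝔽_Γ| - 1`**: the multipliers form a subgroup of the unit group of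
the stabiliser field (Faber 2011, §6: "`μ_d(k) ⊂ 𝔽_Γ^× = 𝔽_q^×`"). [cite: Faber2011, Lemma 6.3] -/
theorem card_Lambda_dvd [IsAlgClosed k] (P : Sylow p H) (hP1 : (P : Subgroup H) ≠ ⊥)
    (hPi : (P : Subgroup H) ≤ stabilizer H (∞ : OnePoint k)) :
    Nat.card (Lambda H) ∣ Nat.card (stabField (Gamma H)) - 1 := by
  have hΓ := Gamma_ne_bot p H P hP1 hPi
  haveI : Finite (stabField (Gamma H)) := finite_stabField hΓ
  -- the injective homomorphism `Λ → 𝔽_Γˣ`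
  let φ : Lambda H →* (stabField (Gamma H))ˣ :=
    { toFun := fun a => ⟨⟨(a : kˣ), coe_mem_stabField_of_mem_Lambda a.2⟩,
        ⟨((a : kˣ)⁻¹ : kˣ), coe_mem_stabField_of_mem_Lambda (inv_mem a.2)⟩,
        Subtype.ext (by simp), Subtype.ext (by simp)⟩
      map_one' := Units.ext (Subtype.ext rfl)
      map_mul' := fun a b => Units.ext (Subtype.ext rfl) }
  have hφ : Function.Injective φ := by
    intro a b hab
    have := congrArg (fun u : (stabField (Gamma H))ˣ => ((u : stabField (Gamma H)) : k)) hab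
    exact Subtype.ext (Units.ext this)
  rw [← Nat.card_units]
  exact Subgroup.card_dvd_of_injective φ hφ

/-- **`(q - 1)/ε_p ≤ d ∣ q - 1`**: the two constraints on `d = |Λ|` from Faber's Lemma 6.3, in
normalised form (`q = |P| = |𝔽_Γ|`): `d ∣ q - 1` and `q - 1 ≤ ε_p d`; hence `d = q - 1`, or `p` is
odd and `d = (q-1)/2` (Faber 2011, Lemma 6.3: "`Λ = 𝔽_qˣ` or `Λ = (𝔽_qˣ)²`").
[cite: Faber2011, Lemma 6.3] -/
theorem card_Lambda_eq_or [IsAlgClosed k] (P : Sylow p H) (hP1 : (P : Subgroup H) ≠ ⊥)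
    (hPi : (P : Subgroup H) ≤ stabilizer H (∞ : OnePoint k))
    (hS : stabilizer H (∞ : OnePoint k) ≠ ⊤) :
    Nat.card (Lambda H) = Nat.card (P : Subgroup H) - 1 ∨
      (p ≠ 2 ∧ 2 * Nat.card (Lambda H) = Nat.card (P : Subgroup H) - 1) := by
  have hdvd := card_Lambda_dvd p H P hP1 hPi
  have hle := card_sylow_sub_one_le p H P hP1 hPi hS
  rw [card_stabField_eq p H P hP1 hPi hS, card_Gamma_eq_card_sylow p H P hPi] at hdvd
  set d := Nat.card (Lambda H) with hd
  set q := Nat.card (P : Subgroup H) with hq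
  obtain ⟨c, hc⟩ := hdvd
  have hq1 : 0 < q - 1 := by
    have : 1 < q := (Subgroup.one_lt_card_iff_ne_bot _).mpr hP1
    omega
  haveI : Finite (Lambda H) := Finite.of_surjective _ (stabDeriv H).rangeRestrict_surjective
  have hd0 : 0 < d := Nat.card_pos
  by_cases hp : p = 2
  · left
    rw [if_pos hp, one_mul] at hle
    exact le_antisymm (Nat.le_of_dvd hq1 ⟨c, hc⟩) hle
  · rw [if_neg hp] at hle
    have hc2 : c ≤ 2 := by
      by_contra hlt
      have : d * 3 ≤ d * c := Nat.mul_le_mul_left d (by omega)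
      omega
    interval_cases c
    · omega
    · left
      omega
    · exact Or.inr ⟨hp, by omega⟩

end Consequences

end Literature.GroupTheory.SpecificGroups.PGL2
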